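import Summits.HodgeConjecture.HodgeConjecture.Theorems.VHCAbelianSchemesRoadSecondCarriedOfTGRR
import Summits.HodgeConjecture.HodgeConjecture.Theorems.VHCAbelianSchemesRoadSecantQuotientAnchorCMOneAnchorAmple

/-!
# (P2) `SecantQuotientPinnedWeilPlaneRigidity` is FALSE modulo a level-fixing polarised symmetry that moves the Weil plane

Refuter lane `Theorems/SecantQuotientPinnedWeilPlaneRigidity/Negative/` for the in-house node (P2)
`Summit.HodgeConjecture.HodgeConjecture.Ring2.SemiregularRepresentatives.SecantQuotientPinnedWeilPlaneRigidity` (p641318, the residue of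
child (c3) of crux stmt-HodgeConjecture-26512, route №4 `VHCAbelianSchemesRoad`): «every class pinned-served at a datum's own chart
`(D.Y.X, h_Y(θ₀))` pulls back under `D`'s own `q` into `D`'s own Weil plane `W(D) = weilClassesOf D.P D.ψ 3 D.d`».

MECHANISM (kernel-checked here, no residual hypothesis): the pinned served set is transported by scheme isomorphisms
(`IsSecantQuotientWeilClassAtPinned.of_iso`), so it is stable under every automorphism `e` of `D.Y.X` fixing `h_Y(θ₀)`; hence (P2) at `(D, θ₀)`
forces `q^*(e^*γ₁) ∈ W(D)` for every pinned-served `γ₁` (`map_q_map_mem_weilClassesOf_of_rigidityAt`). If `e` is the descent of an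
endomorphism `β` of `P = J × Ĵ` through `q` (`q ≫ e = β ≫ q`), then `q^*(e^*γ₁) = β^*(q^*γ₁)` (`complexBetti_map_q_map_of_intertwiner`), so a
`β` FIXING `Ξ_d(θ₀) = q^*h_Y(θ₀)` but MOVING one rational Weil class `q^*γ₁ ∈ W(D)` out of `W(D)` refutes (P2) at `(D, θ₀)`
(`not_rigidityAt_of_intertwiner`); two of the three own-chart clauses needed to serve `γ₁` through `D` itself are theorems of the tree
(`isPolarizationClass_hY`, `exists_isAmple_isPolarizationClassOf_hY`), the third (hyperbolicity, Markman Lemma 3.1.3) is carried.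

WITNESS (paper; NOT constructible in the tree, which has no genus-3 Jacobian — hence a negative lemma MODULO `H`, not a refutation):
a bielliptic non-hyperelliptic genus-3 curve `C → E` with bielliptic involution `σ`, Prym surface `A = im(1 − σ) ⊂ J` (`σ|_A = −1`), odd level
`ℓ = d + 1`, BOTH cyclic groups `G₁, G₂ ≤ A[ℓ] ≅ (ℤ/ℓ)⁴`; `α := −σ ∈ Aut(J, [Θ]) ∖ {±1}` is the identity on `G₁ + G₂`, so `β := α × 1_Ĵ`
fixes `Ḡ = {(x₁ − x₂, φ_Θ(x₁ + x₂))}` pointwise (descends to `e ∈ Aut Y`) and fixes `Ξ_d(θ₀) = p₁^*θ₀ + d·p₂^*θ̂₀`, while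
`β ψ β⁻¹ = (−d·αφ_Θ⁻¹ ∣ φ_Θα⁻¹) ≠ ±ψ`, so `β^*W ≠ W` (`W ⊗ ℂ = det V₊ ⊕ det V₋`; Plücker) and some rational `q^*γ₁ ∈ W` leaves `W`.
Concrete instance: `C₃ : y⁴ = x(x−1)(x−3)`, `σ : y ↦ −y`, `d = 4`, `G₁, G₂ ≤ A[5]` (refute-markman W9 RESULT B; H-good numerically);
Lemma 9.3.1's general position of the `25` translates is UNVERIFIED there (the one open clause of `H`). The configuration `G₁, G₂ ≤ π^*E[ℓ]`,
`α = σ` is NOT a witness: all translates `Θ_s`, `s ∈ π^*E`, pass through `[π^*e₀] − κ`, violating `TranslatesInGeneralPosition`.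
For `End J = ℤ` no such `β` exists (the Rosati-antisymmetric part of `End⁰(J × Ĵ) = M₂(ℚ)` for `Ξ_d` is `ℚ·ψ`), consistent with the node's
docstring; the lemma shows that restricting the anchor family to non-hyperelliptic H-good data does NOT rescue (P2)
(`not_rigidityAtHGood_of_intertwiner`): the repair is an `End`-triviality hypothesis on `J` or re-keying `𝔖^pin` to the presenting datum.

NOT CLAIMED: `¬ (P2)` unconditionally, (P1), any stub, 26512, `HC_CM`, HC. `H` is filed for construction; the node stays OPEN.
References: [cite: Markman2025SecantWeil, §1.5 (p. 7), Thm. 1.4.1 (item 4), §3.1 Lemma 3.1.3, §3.2 Cor. 3.2.3 and §9.3 Lemma 9.3.1]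
[cite: vanGeemen1994HodgeAV, 4.9 and Lemma 5.2] [cite: MumfordAV1970, §7 Thm. 4 (p. 72)] [cite: Lange2023AbelianVarietiesComplex, §2.1.1 (p. 68)]
-/

-- `Summit.HodgeConjecture.HodgeConjecture.…` repeats the summit name by the D-0017 layout (Sub = Summit).
set_option linter.dupNamespace false

noncomputable section

open CategoryTheory AlgebraicGeometry
open Literature.AlgebraicGeometry Literature.AlgebraicGeometry.Motives Literature.AlgebraicGeometry.Motives.AbelianVariety
open Literature.AlgebraicGeometry.HodgeTheory Literature.AlgebraicGeometry.Markman2025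
open Literature.AlgebraicTopology.SingularHomology
open Summit.HodgeConjecture.HodgeConjecture.Ring2.SemiregularRepresentatives

namespace Summit.HodgeConjecture.HodgeConjecture.Theorems.SecantQuotientPinnedWeilPlaneRigidity.Negative

/-- An isomorphism of complex abelian varieties has an underlying isomorphism of `ℂ`-schemes (forget the group structure). [folklore] -/
theorem exists_schemeIso_hom_eq {A B : AbelianVariety ℂ} (g : A ≅ B) : ∃ e : A.X ≅ B.X, e.hom = g.hom.hom.hom.hom :=
  ⟨⟨g.hom.hom.hom.hom, g.inv.hom.hom.hom, congrArg (fun f => f.hom.hom.hom) g.hom_inv_id,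
    congrArg (fun f => f.hom.hom.hom) g.inv_hom_id⟩, rfl⟩

/-- **THE PINNED SERVED SET IS `Aut`-STABLE**: for a scheme automorphism `e` of `D.Y.X` fixing the pin `h_Y(θ₀)`, `e^*` maps
`𝔖^pin(D.Y.X, h_Y(θ₀))` into itself (transport of the presentation, `IsSecantQuotientWeilClassAtPinned.of_iso`). [cite: Markman2025SecantWeil, Thm. 1.4.1] -/
theorem map_mem_servedClassesPinned_of_schemeIso (D : SecantQuotientDatum) (θ₀ : complexBetti D.𝒥.J.X 2) (e : D.Y.X ≅ D.Y.X)
    (he : complexBetti.map e.hom 2 (D.hY θ₀) = D.hY θ₀) {γ₁ : complexBetti D.Y.X (2 * 3)}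
    (hγ₁ : γ₁ ∈ secantQuotientServedClassesPinned D.Y.X (D.hY θ₀)) :
    complexBetti.map e.hom (2 * 3) γ₁ ∈ secantQuotientServedClassesPinned D.Y.X (D.hY θ₀) := by
  have h := IsSecantQuotientWeilClassAtPinned.of_iso e hγ₁
  rw [he] at h
  exact h

/-- **(P2) at `(D, θ₀)` FORCES `Aut`-INVARIANCE of the `q`-Weil condition on the served set**: under the pointwise rigidity clause, every scheme
automorphism `e` of `D.Y.X` fixing `h_Y(θ₀)` satisfies `q^*(e^*γ₁) ∈ W(D)` for every pinned-served `γ₁`. [cite: Markman2025SecantWeil, Thm. 1.4.1 (item 4)] -/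
theorem map_q_map_mem_weilClassesOf_of_rigidityAt (D : SecantQuotientDatum) (θ₀ : complexBetti D.𝒥.J.X 2) (h : ∀ γ ∈ secantQuotientServedClassesPinned D.Y.X (D.hY θ₀),
      complexBetti.map D.q.hom.hom.hom (2 * 3) γ ∈ weilClassesOf D.P D.ψ 3 D.d)
    (e : D.Y.X ≅ D.Y.X) (he : complexBetti.map e.hom 2 (D.hY θ₀) = D.hY θ₀) {γ₁ : complexBetti D.Y.X (2 * 3)}
    (hγ₁ : γ₁ ∈ secantQuotientServedClassesPinned D.Y.X (D.hY θ₀)) :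
    complexBetti.map D.q.hom.hom.hom (2 * 3) (complexBetti.map e.hom (2 * 3) γ₁) ∈ weilClassesOf D.P D.ψ 3 D.d :=
  h _ (map_mem_servedClassesPinned_of_schemeIso D θ₀ e he hγ₁)

/-- **A pin-fixing automorphism moving one served class off `W(D)` refutes (P2) at `(D, θ₀)`.** [cite: Markman2025SecantWeil, Thm. 1.4.1 (item 4)] -/
theorem not_rigidityAt_of_schemeIso (D : SecantQuotientDatum) (θ₀ : complexBetti D.𝒥.J.X 2) (e : D.Y.X ≅ D.Y.X)
    (he : complexBetti.map e.hom 2 (D.hY θ₀) = D.hY θ₀) {γ₁ : complexBetti D.Y.X (2 * 3)}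
    (hγ₁ : γ₁ ∈ secantQuotientServedClassesPinned D.Y.X (D.hY θ₀))
    (hmove : complexBetti.map D.q.hom.hom.hom (2 * 3) (complexBetti.map e.hom (2 * 3) γ₁) ∉ weilClassesOf D.P D.ψ 3 D.d) :
    ¬ ∀ γ ∈ secantQuotientServedClassesPinned D.Y.X (D.hY θ₀),
        complexBetti.map D.q.hom.hom.hom (2 * 3) γ ∈ weilClassesOf D.P D.ψ 3 D.d :=
  fun h ↦ hmove (map_q_map_mem_weilClassesOf_of_rigidityAt D θ₀ h e he hγ₁)

/-- **DESCENDED SYMMETRIES**: for an automorphism `e` of `Y` that is the descent through `q` of an endomorphism `β` of `P = J × Ĵ`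
(`q ≫ e = β ≫ q`) with `β^*Ξ_d(θ₀) = Ξ_d(θ₀)` (`Ξ_d(θ₀) = q^*h_Y(θ₀)`), `e` fixes the pin: `e^*h_Y(θ₀) = h_Y(θ₀)` (`q^*` is injective).
[cite: Markman2025SecantWeil, §1.5 (p. 7) and §3.2 Cor. 3.2.3] [cite: vanGeemen1994HodgeAV, §3.6 (p. 236)] -/
theorem map_hY_eq_of_intertwiner (D : SecantQuotientDatum) (θ₀ : complexBetti D.𝒥.J.X 2) {β : D.P ⟶ D.P} (e : D.Y ≅ D.Y)
    (hqe : D.q ≫ e.hom = β ≫ D.q)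
    (hβΞ : complexBetti.map β.hom.hom.hom 2 (complexBetti.map D.q.hom.hom.hom 2 (D.hY θ₀)) =
      complexBetti.map D.q.hom.hom.hom 2 (D.hY θ₀)) :
    complexBetti.map e.hom.hom.hom.hom 2 (D.hY θ₀) = D.hY θ₀ := by
  apply (D.complexBetti_map_q_bijective 2).1
  rw [D.complexBetti_map_q_map_of_intertwiner hqe, hβΞ]

/-- **THE REFUTATION PATTERN AT A DATUM** (`not_rigidityAt_of_intertwiner`): an automorphism `e` of `Y` descending an endomorphism `β` of `J × Ĵ`
(`q ≫ e = β ≫ q`) which FIXES `Ξ_d(θ₀)` but MOVES the pull-back `q^*γ₁ ∈ W(D)` of one pinned-served class `γ₁` OUT of `W(D)` refutes (P2) at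
`(D, θ₀)`: `e^*γ₁` is pinned-served (transport) and `q^*(e^*γ₁) = β^*(q^*γ₁) ∉ W(D)`. [cite: Markman2025SecantWeil, Thm. 1.4.1 (item 4) and §1.5 (p. 7)] -/
theorem not_rigidityAt_of_intertwiner (D : SecantQuotientDatum) (θ₀ : complexBetti D.𝒥.J.X 2) {β : D.P ⟶ D.P} (e : D.Y ≅ D.Y)
    (hqe : D.q ≫ e.hom = β ≫ D.q)
    (hβΞ : complexBetti.map β.hom.hom.hom 2 (complexBetti.map D.q.hom.hom.hom 2 (D.hY θ₀)) =
      complexBetti.map D.q.hom.hom.hom 2 (D.hY θ₀))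
    {γ₁ : complexBetti D.Y.X (2 * 3)} (hγ₁ : γ₁ ∈ secantQuotientServedClassesPinned D.Y.X (D.hY θ₀))
    (hmove : complexBetti.map β.hom.hom.hom (2 * 3) (complexBetti.map D.q.hom.hom.hom (2 * 3) γ₁) ∉ weilClassesOf D.P D.ψ 3 D.d) :
    ¬ ∀ γ ∈ secantQuotientServedClassesPinned D.Y.X (D.hY θ₀),
        complexBetti.map D.q.hom.hom.hom (2 * 3) γ ∈ weilClassesOf D.P D.ψ 3 D.d := by
  obtain ⟨e', he'⟩ := exists_schemeIso_hom_eq e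
  refine not_rigidityAt_of_schemeIso D θ₀ e' ?_ hγ₁ ?_
  · rw [he']; exact map_hY_eq_of_intertwiner D θ₀ e hqe hβΞ
  · rw [he', D.complexBetti_map_q_map_of_intertwiner hqe]; exact hmove

/-- **Serving `γ₁` through `D` itself**: at a polarisation class `θ₀` of `Θ`, given hyperbolicity of `(J × Ĵ, φ_d)` for `Ξ_d(θ₀)` (Markman
Lemma 3.1.3 — the one own-chart clause not yet a theorem of the tree; `isPolarizationClass_hY` and `exists_isAmple_isPolarizationClassOf_hY`
supply the other two), every non-zero rational `γ₁` with `q^*γ₁ ∈ W(D)` is pinned-served at `(D.Y.X, h_Y(θ₀))`.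
[cite: Markman2025SecantWeil, §1.5 (p. 7), §3.1 Lemma 3.1.3 and §3.2 Cor. 3.2.3] [cite: vanGeemen1994HodgeAV, Lemma 5.2] -/
theorem mem_servedClassesPinned_of_hyperbolic (D : SecantQuotientDatum) {θ₀ : complexBetti D.𝒥.J.X 2}
    (hθ₀ : D.𝒥.J.IsPolarizationClassOf D.Θ θ₀) (hhyp : IsHyperbolicWeilType D.P D.ψ 3 (complexBetti.map D.q.hom.hom.hom 2 (D.hY θ₀)))
    {γ₁ : complexBetti D.Y.X (2 * 3)} (hγQ : IsRationalClass γ₁) (hγ0 : γ₁ ≠ 0)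
    (hW : complexBetti.map D.q.hom.hom.hom (2 * 3) γ₁ ∈ weilClassesOf D.P D.ψ 3 D.d) :
    γ₁ ∈ secantQuotientServedClassesPinned D.Y.X (D.hY θ₀) :=
  D.setOf_ne_zero_rational_weil_subset_servedClassesPinned hθ₀ (D.isPolarizationClass_hY hθ₀)
    (D.exists_isAmple_isPolarizationClassOf_hY hθ₀) hhyp ⟨hγ0, hγQ, hW⟩

/-- **`H` — A LEVEL-FIXING POLARISED SYMMETRY MOVING THE WEIL PLANE EXISTS** (`WeilPlaneMovingLevelSymmetryExists`): there are a secant–quotient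
datum `D`, a polarisation class `θ₀` of `Θ` at which `(J × Ĵ, φ_d)` is hyperbolic for `Ξ_d(θ₀)` (Markman Lemma 3.1.3, print-level for every datum),
an endomorphism `β` of `P = J × Ĵ` and an automorphism `e` of `Y = P/Ḡ` with `q ≫ e = β ≫ q` (i.e. `β(Ḡ) = Ḡ`: `β` preserves the LEVEL structure)
and `β^*Ξ_d(θ₀) = Ξ_d(θ₀)` (`β` is a symmetry of the POLARISATION), and a non-zero rational class `γ₁` on `Y` with `q^*γ₁` in the Weil plane
`W(D)` but `β^*(q^*γ₁) ∉ W(D)`. Intended inhabitant (module docstring): a bielliptic non-hyperelliptic genus-3 curve, `β = (−σ) × 1_Ĵ`,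
`G₁, G₂ ≤ Prym[d+1]` (e.g. `y⁴ = x(x−1)(x−3)`, `d = 4`), subject to Lemma 9.3.1's general position of the `(d+1)²` translates — a CONSTRUCTION
the tree cannot perform today (no genus-3 Jacobian over Mathlib schemes; Markman §1.5, Lemma 3.1.3, Lemma 9.3.1; Mumford §7 Thm. 4).
HYPOTHESIS of this negative lemma (filed `--negative-modulo WeilPlaneMovingLevelSymmetryExists`); NOT a Literature fact, NOT in print,
nothing asserted. -/
def WeilPlaneMovingLevelSymmetryExists : Prop :=
  ∃ (D : SecantQuotientDatum) (θ₀ : complexBetti D.𝒥.J.X 2) (β : D.P ⟶ D.P) (e : D.Y ≅ D.Y) (γ₁ : complexBetti D.Y.X (2 * 3)),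
    D.𝒥.J.IsPolarizationClassOf D.Θ θ₀ ∧
    IsHyperbolicWeilType D.P D.ψ 3 (complexBetti.map D.q.hom.hom.hom 2 (D.hY θ₀)) ∧
    D.q ≫ e.hom = β ≫ D.q ∧
    complexBetti.map β.hom.hom.hom 2 (complexBetti.map D.q.hom.hom.hom 2 (D.hY θ₀)) = complexBetti.map D.q.hom.hom.hom 2 (D.hY θ₀) ∧
    IsRationalClass γ₁ ∧ γ₁ ≠ 0 ∧
    complexBetti.map D.q.hom.hom.hom (2 * 3) γ₁ ∈ weilClassesOf D.P D.ψ 3 D.d ∧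
    complexBetti.map β.hom.hom.hom (2 * 3) (complexBetti.map D.q.hom.hom.hom (2 * 3) γ₁) ∉ weilClassesOf D.P D.ψ 3 D.d

/-- **(P2) IS FALSE MODULO `H`** (`secantQuotientPinnedWeilPlaneRigidity_false_of_weilPlaneMovingLevelSymmetryExists`): a level-fixing polarised
symmetry moving the Weil plane at one datum refutes `SecantQuotientPinnedWeilPlaneRigidity` — serve `γ₁` through `D` itself
(`mem_servedClassesPinned_of_hyperbolic`), transport it by the descended automorphism, and read `q^*(e^*γ₁) = β^*(q^*γ₁) ∉ W(D)`
(`not_rigidityAt_of_intertwiner`). [cite: Markman2025SecantWeil, Thm. 1.4.1 (item 4), §1.5 (p. 7) and §3.1 Lemma 3.1.3] -/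
theorem secantQuotientPinnedWeilPlaneRigidity_false_of_weilPlaneMovingLevelSymmetryExists :
    WeilPlaneMovingLevelSymmetryExists → ¬ SecantQuotientPinnedWeilPlaneRigidity := by
  rintro ⟨D, θ₀, β, e, γ₁, hθ₀, hhyp, hqe, hβΞ, hγQ, hγ0, hW, hmove⟩ h
  exact not_rigidityAt_of_intertwiner D θ₀ e hqe hβΞ (mem_servedClassesPinned_of_hyperbolic D hθ₀ hhyp hγQ hγ0 hW) hmove
    (h D θ₀ hθ₀)

/-- **RESTRICTING TO NON-HYPERELLIPTIC H-GOOD DATA DOES NOT RESCUE (P2)** (`not_rigidityAtHGood_of_intertwiner`): the same symmetry at a datum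
with `¬ IsHyperelliptic` and `OrbitTranslatesDisjoint` (the keying of (c3′)) refutes the (c3′)-restricted rigidity clause — the intended witness
(smooth plane quartic `y⁴ = x(x−1)(x−3)`, H-good by the W9 tables) lies in that family. Stated with explicit binders (no further hypothesis name).
[cite: Markman2025SecantWeil, §9.1 (p. 57), Lemma 9.1.4 and Thm. 1.4.1 (item 4)] -/
theorem not_rigidityAtHGood_of_intertwiner (D : SecantQuotientDatum) (θ₀ : complexBetti D.𝒥.J.X 2) (hnh : ¬ D.𝒥.IsHyperelliptic)
    (hH : OrbitTranslatesDisjoint D.𝒥 D.G₁ D.G₂) (hθ₀ : D.𝒥.J.IsPolarizationClassOf D.Θ θ₀)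
    (hhyp : IsHyperbolicWeilType D.P D.ψ 3 (complexBetti.map D.q.hom.hom.hom 2 (D.hY θ₀))) {β : D.P ⟶ D.P} (e : D.Y ≅ D.Y)
    (hqe : D.q ≫ e.hom = β ≫ D.q)
    (hβΞ : complexBetti.map β.hom.hom.hom 2 (complexBetti.map D.q.hom.hom.hom 2 (D.hY θ₀)) =
      complexBetti.map D.q.hom.hom.hom 2 (D.hY θ₀))
    {γ₁ : complexBetti D.Y.X (2 * 3)} (hγQ : IsRationalClass γ₁) (hγ0 : γ₁ ≠ 0)
    (hW : complexBetti.map D.q.hom.hom.hom (2 * 3) γ₁ ∈ weilClassesOf D.P D.ψ 3 D.d)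
    (hmove : complexBetti.map β.hom.hom.hom (2 * 3) (complexBetti.map D.q.hom.hom.hom (2 * 3) γ₁) ∉ weilClassesOf D.P D.ψ 3 D.d) :
    ¬ ∀ (D : SecantQuotientDatum) (θ₀ : complexBetti D.𝒥.J.X 2), ¬ D.𝒥.IsHyperelliptic → OrbitTranslatesDisjoint D.𝒥 D.G₁ D.G₂ →
        D.𝒥.J.IsPolarizationClassOf D.Θ θ₀ → ∀ γ ∈ secantQuotientServedClassesPinned D.Y.X (D.hY θ₀),
          complexBetti.map D.q.hom.hom.hom (2 * 3) γ ∈ weilClassesOf D.P D.ψ 3 D.d :=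
  fun h ↦ not_rigidityAt_of_intertwiner D θ₀ e hqe hβΞ (mem_servedClassesPinned_of_hyperbolic D hθ₀ hhyp hγQ hγ0 hW) hmove
    (h D θ₀ hnh hH hθ₀)

/-- **MODULO L1″_∀ the hyperbolicity clause is discharged at non-hyperelliptic H-good data** (`SecantQuotientDatum.ownChartClauses_of_pinnedForall`,
p642387): there, a descended level-fixing polarised symmetry moving one rational Weil class refutes (P2) at `(D, θ₀)` with NO clause of (P1) assumed.
[cite: Markman2025SecantWeil, §1.5 (p. 7), Thm. 1.4.1 (item 4) and §3.1 Lemma 3.1.3] -/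
theorem not_rigidityAt_of_intertwiner_of_pinnedForall {C : ChernCharacterBetti} {Adm : PerfectAdmissibility}
    (hLC : Markman2025_secantQuotient_twistedCarrier_onJacobian_pinnedForall C Adm) (D : SecantQuotientDatum)
    (θ₀ : complexBetti D.𝒥.J.X 2) (hnh : ¬ D.𝒥.IsHyperelliptic) (hH : OrbitTranslatesDisjoint D.𝒥 D.G₁ D.G₂)
    (hθ₀ : D.𝒥.J.IsPolarizationClassOf D.Θ θ₀) {β : D.P ⟶ D.P} (e : D.Y ≅ D.Y) (hqe : D.q ≫ e.hom = β ≫ D.q)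
    (hβΞ : complexBetti.map β.hom.hom.hom 2 (complexBetti.map D.q.hom.hom.hom 2 (D.hY θ₀)) =
      complexBetti.map D.q.hom.hom.hom 2 (D.hY θ₀))
    {γ₁ : complexBetti D.Y.X (2 * 3)} (hγQ : IsRationalClass γ₁) (hγ0 : γ₁ ≠ 0)
    (hW : complexBetti.map D.q.hom.hom.hom (2 * 3) γ₁ ∈ weilClassesOf D.P D.ψ 3 D.d)
    (hmove : complexBetti.map β.hom.hom.hom (2 * 3) (complexBetti.map D.q.hom.hom.hom (2 * 3) γ₁) ∉ weilClassesOf D.P D.ψ 3 D.d) :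
    ¬ ∀ γ ∈ secantQuotientServedClassesPinned D.Y.X (D.hY θ₀),
        complexBetti.map D.q.hom.hom.hom (2 * 3) γ ∈ weilClassesOf D.P D.ψ 3 D.d :=
  not_rigidityAt_of_intertwiner D θ₀ e hqe hβΞ
    (mem_servedClassesPinned_of_hyperbolic D hθ₀ (D.ownChartClauses_of_pinnedForall hLC hnh hH hθ₀).2 hγQ hγ0 hW) hmove


end Summit.HodgeConjecture.HodgeConjecture.Theorems.SecantQuotientPinnedWeilPlaneRigidity.Negative

end
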